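import Summits.Langlands.Langlands.Theorems.PhantomRMYoshidaResiduallyYoshidaLiftingNonsplitIndecomposable
import Summits.Langlands.Langlands.Theorems.PhantomRMYoshidaResiduallyYoshidaLiftingReducibleRealiserOrientation
import Summits.Langlands.Langlands.Theorems.PhantomRMYoshidaResiduallyYoshidaLiftingSymplecticBlockDichotomy
import Summits.Langlands.Langlands.Theorems.PhantomRMYoshidaResiduallyYoshidaLiftingTwistOfDualCharpoly
import Summits.Langlands.Langlands.Theorems.PhantomRMYoshidaResiduallyYoshidaLiftingBlockTriangularCharpolyReduction
import Summits.Langlands.Langlands.Theorems.PhantomRMYoshidaResiduallyYoshidaLiftingLagrangianQuotientCharpoly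
import Summits.Langlands.Langlands.Theorems.ResiduallyYoshidaLifting.Negative.ShSymplecticPlaneDichotomy
import Mathlib.Tactic.NoncommRing
import HarnessLib

/-!
# No stable plane for symplectic realisers of a non-trivial class (stub `stub_noStablePlaneSymplectic`, T8-plane)
# — line `sector-klingen-split`, crux `ResiduallyYoshidaLifting` (stmt-Langlands-13639)

Stub-worker file of lead prover-line-stmt-Langlands-13639-c4-0 (cycle 4, wave 3, 2026-08-17), namespace
`…SectorKlingenSplit.Fibre`: the Siegel/endoscopic half of the lead's theorem T8 "every symplectic realiser of a
non-trivial class on a non-twist fibre is irreducible".  Notation: `ℤ̄_p = 𝒪[ℚ̄_p] = Valued.integer (PadicAlgCl p)`.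

**Statement (`stub_noStablePlaneSymplectic`).**  `red : ℤ̄_p → k` to an algebraically closed field of characteristic
`p ≠ 2`; `σ, σ' : Γ → GL₂(k)` irreducible, `σ'` NOT a pointwise-scalar twist of a conjugate of `σ`; `B` not a coboundary.
If the homomorphism `rint : Γ → GL₄(ℤ̄_p)` reduces through `red` to `h (σ, B; 0, σ') h⁻¹` and is symplectic over `ℚ̄_p`
for a non-degenerate alternating `J` with multiplier `ν`, then `rint` has NO stable plane.

**Proof** (assembly of the landed T4, T5, T6, T7, T8b, T8c and p146441; the helpers below are Mathlib-only).
(1) Saturate the plane (T4): integral `N` with an identity block in rows `i ≠ j`, integral `T g`, `rint g N = N T g`;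
`T` is a homomorphism `Γ → GL₂(ℤ̄_p)` (`N` is left-cancellable).  (2) Complete `N` by two coordinate columns to
`Q ∈ GL₄(ℤ̄_p)` with `Q⁻¹ rint Q = (T, C; 0, τ')` (`exists_blockTriangularFrame`; explicit inverse frame, no determinant).
(3) `red N` is a stable plane of `h (σ, B; 0, σ') h⁻¹`, so `red T ∼ σ` (T5) and `charpoly (red τ') = charpoly σ'` (T8b).
(4) `ν` is a character `χ : Γ → ℤ̄_pˣ` (`ν(gh) J = ν(g)ν(h) J`, `‖ν‖⁴ = ‖det‖² = 1`); in the frame `Q`,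
`J' = Qᵀ J Q = (J₁₁, X; -Xᵀ, Y)` and `(T, C; 0, τ')` is a similitude of `J'`, so the symplectic block dichotomy (T6, `2 ≠ 0`
in `ℚ̄_p`) leaves two cases.  Lagrangian (`Tᵀ X τ' = ν X`): T8c gives `charpoly (red τ') = charpoly (χ̄ (red T)ᵀ⁻¹)`,
`red T = Ab⁻¹ σ Ab` makes this `charpoly σ' = charpoly (χ̄ σᵀ⁻¹)`, and T7 yields a twist pair — excluded.
Block-diagonalisable (`C = Z τ' - T Z`): `Q (1, Z; 0, 1)` conjugates `rint` to `T ⊕ τ'`, contradicting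
`Ribet.not_blockDiagonal_of_realises_nonsplit` (p146441).
-/

noncomputable section

-- `Summit.Langlands.Langlands.…` (summit = sub-problem name, D-0017 layout) trips `dupNamespace` on every decl.
set_option linter.dupNamespace false
set_option autoImplicit false

open scoped Matrix Valued

namespace Summit.Langlands.Langlands.Cruxes.ResiduallyYoshidaLifting.SectorKlingenSplit.Fibre

open Literature.NumberTheory.GaloisRepresentations Summit.Langlands.Langlands.Theorems.ResiduallyYoshidaLifting.Negative
open Summit.Langlands.Langlands.Cruxes.ResiduallyYoshidaLifting.EndoscopicCrossingEuler

/-! ### Helpers over a commutative ring: block-triangularising frame, action homomorphism, block bookkeeping -/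

section Frame

variable {O : Type*} [CommRing O]

/-- If the rectangular frame `(N | P) : O^{4 × (2 ⊕ 2)}` has a left inverse and the column span of `N` is stable under
the matrices `rint g` with action `T g`, then in the square frame `Q = (N | P) ∈ GL₄(O)` every `rint g` is block upper
triangular with top block `T g` (blocks along `finSumFinEquiv`). [folklore] -/
theorem exists_blockTriangularFrame_of_inverse {Γ : Type*} (rint : Γ → Matrix (Fin 4) (Fin 4) O)
    (N : Matrix (Fin 4) (Fin 2) O) (T : Γ → Matrix (Fin 2) (Fin 2) O) (hT : ∀ g, rint g * N = N * T g)
    (P : Matrix (Fin 4) (Fin 2) O) (Qi' : Matrix (Fin 2 ⊕ Fin 2) (Fin 4) O) (hQiQ : Qi' * Matrix.fromCols N P = 1) :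
    ∃ (Q : GL (Fin 4) O) (C τ' : Γ → Matrix (Fin 2) (Fin 2) O), ∀ g, (Q⁻¹).val * rint g * Q.val =
      Matrix.reindex finSumFinEquiv finSumFinEquiv (Matrix.fromBlocks (T g) (C g) 0 (τ' g)) := by
  obtain ⟨Q', hQ'⟩ : ∃ Q' : Matrix (Fin 4) (Fin 2 ⊕ Fin 2) O, Q' = Matrix.fromCols N P := ⟨_, rfl⟩
  rw [← hQ'] at hQiQ
  have hQQi : Q' * Qi' = 1 := by
    rw [← Matrix.fromRows_toRows Qi', hQ'] at hQiQ ⊢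
    exact (Matrix.fromCols_mul_fromRows_eq_one_comm (finSumFinEquiv (m := 2) (n := 2)).symm N P _ _).mpr hQiQ
  -- square versions along `finSumFinEquiv`
  have hsq1 : Q'.submatrix id (finSumFinEquiv (m := 2) (n := 2)).symm *
      Qi'.submatrix (finSumFinEquiv (m := 2) (n := 2)).symm id = 1 := by
    rw [Matrix.submatrix_mul_equiv, hQQi, Matrix.submatrix_id_id]
  have hsq2 : Qi'.submatrix (finSumFinEquiv (m := 2) (n := 2)).symm id *
      Q'.submatrix id (finSumFinEquiv (m := 2) (n := 2)).symm = 1 := by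
    rw [← Matrix.submatrix_mul _ _ _ id _ Function.bijective_id, hQiQ, Matrix.submatrix_one_equiv]
  obtain ⟨Q, hQv, hQi⟩ : ∃ Q : GL (Fin 4) O, Q.val = Q'.submatrix id (finSumFinEquiv (m := 2) (n := 2)).symm ∧
      (Q⁻¹).val = Qi'.submatrix (finSumFinEquiv (m := 2) (n := 2)).symm id := ⟨⟨_, _, hsq1, hsq2⟩, rfl, rfl⟩
  refine ⟨Q, fun g => (Qi' * rint g * Q').toBlocks₁₂, fun g => (Qi' * rint g * Q').toBlocks₂₂, fun g => ?_⟩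
  -- the first block column of `Qi' * rint g * Q'` is `(T g; 0)`
  have hQ'E : Q' * Matrix.fromRows (1 : Matrix (Fin 2) (Fin 2) O) (0 : Matrix (Fin 2) (Fin 2) O) = N := by
    rw [hQ', Matrix.fromCols_mul_fromRows, Matrix.mul_one, Matrix.mul_zero, add_zero]
  have hQiN : Qi' * N = Matrix.fromRows (1 : Matrix (Fin 2) (Fin 2) O) (0 : Matrix (Fin 2) (Fin 2) O) := by
    rw [← hQ'E, ← Matrix.mul_assoc, hQiQ, Matrix.one_mul]
  have hR : Qi' * rint g * Q' * Matrix.fromRows (1 : Matrix (Fin 2) (Fin 2) O) (0 : Matrix (Fin 2) (Fin 2) O) =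
      Matrix.fromRows (T g) (0 : Matrix (Fin 2) (Fin 2) O) := by
    rw [Matrix.mul_assoc, hQ'E, Matrix.mul_assoc, hT g, ← Matrix.mul_assoc, hQiN, Matrix.fromRows_mul,
      Matrix.one_mul, Matrix.zero_mul]
  have hblk : Qi' * rint g * Q' =
      Matrix.fromBlocks (T g) (Qi' * rint g * Q').toBlocks₁₂ 0 (Qi' * rint g * Q').toBlocks₂₂ := by
    rw [← Matrix.fromBlocks_toBlocks (Qi' * rint g * Q'), Matrix.fromBlocks_mul_fromRows, Matrix.mul_one,
      Matrix.mul_one, Matrix.mul_zero, Matrix.mul_zero, add_zero, add_zero, Matrix.fromRows_ext_iff] at hR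
    conv_lhs => rw [← Matrix.fromBlocks_toBlocks (Qi' * rint g * Q')]
    rw [hR.1, hR.2]
  rw [hQv, hQi, Matrix.reindex_apply, ← hblk, Matrix.submatrix_mul _ Q' _ id _ Function.bijective_id,
    Matrix.submatrix_mul Qi' _ _ id _ Function.bijective_id, Matrix.submatrix_id_id]

/-- **Block-triangularising frame.**  An `N : O^{4 × 2}` with an identity `2 × 2` block in rows `i ≠ j` whose column
span is stable under matrices `rint g` (`rint g * N = N * T g`) is completed by the two complementary coordinate columns
to `Q ∈ GL₄(O)` with `Q⁻¹ (rint g) Q = (T g, C g; 0, τ' g)`; the inverse frame is written down explicitly. [folklore] -/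
theorem exists_blockTriangularFrame {Γ : Type*} (rint : Γ → Matrix (Fin 4) (Fin 4) O)
    (N : Matrix (Fin 4) (Fin 2) O) (i j : Fin 4) (hij : i ≠ j)
    (hNi0 : N i 0 = 1) (hNi1 : N i 1 = 0) (hNj0 : N j 0 = 0) (hNj1 : N j 1 = 1)
    (T : Γ → Matrix (Fin 2) (Fin 2) O) (hT : ∀ g, rint g * N = N * T g) :
    ∃ (Q : GL (Fin 4) O) (C τ' : Γ → Matrix (Fin 2) (Fin 2) O), ∀ g, (Q⁻¹).val * rint g * Q.val =
      Matrix.reindex finSumFinEquiv finSumFinEquiv (Matrix.fromBlocks (T g) (C g) 0 (τ' g)) := by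
  obtain ⟨a, b, hab, hia, hja, hib, hjb⟩ :=
    (by decide : ∀ i j : Fin 4, i ≠ j → ∃ a b : Fin 4, a ≠ b ∧ i ≠ a ∧ j ≠ a ∧ i ≠ b ∧ j ≠ b) i j hij
  -- the complementary coordinate columns `P` and the two block rows `Y₁, Y₂` of the inverse frame
  let P : Matrix (Fin 4) (Fin 2) O := Matrix.of fun r c => if r = ![a, b] c then 1 else 0
  let Y₁ : Matrix (Fin 2) (Fin 4) O := Matrix.of fun c r => if r = ![i, j] c then 1 else 0
  let Y₂ : Matrix (Fin 2) (Fin 4) O := Matrix.of fun c r =>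
    (if r = ![a, b] c then 1 else 0) - N (![a, b] c) 0 * (if r = i then 1 else 0) -
      N (![a, b] c) 1 * (if r = j then 1 else 0)
  have hY₁N : Y₁ * N = 1 := by
    ext c c'
    fin_cases c <;> fin_cases c' <;> simp [Y₁, Matrix.mul_apply, hNi0, hNi1, hNj0, hNj1]
  have hY₁P : Y₁ * P = 0 := by
    ext c c'
    fin_cases c <;> fin_cases c' <;> simp [Y₁, P, Matrix.mul_apply, hia.symm, hja.symm, hib.symm, hjb.symm]
  have hY₂N : Y₂ * N = 0 := by
    ext c c'
    fin_cases c <;> fin_cases c' <;>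
      simp [Y₂, Matrix.mul_apply, sub_mul, Finset.sum_sub_distrib, hNi0, hNi1, hNj0, hNj1]
  have hY₂P : Y₂ * P = 1 := by
    ext c c'
    fin_cases c <;> fin_cases c' <;>
      simp [Y₂, P, Matrix.mul_apply, hab, hab.symm, hia.symm, hja.symm, hib.symm, hjb.symm]
  refine exists_blockTriangularFrame_of_inverse rint N T hT P (Matrix.fromRows Y₁ Y₂) ?_
  rw [Matrix.fromRows_mul_fromCols, hY₁N, hY₁P, hY₂N, hY₂P, Matrix.fromBlocks_one]

/-- **The action on a saturated stable plane is a homomorphism**: for `rint : Γ → GL₄(O)` a homomorphism and `N` with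
an identity block in rows `i, j`, the matrices `T g` with `rint g * N = N * T g` form a homomorphism `Γ → GL₂(O)`
(`N` is left-cancellable: rows `i, j` of `N * S` are the rows of `S`). [folklore] -/
theorem exists_unitsHom_of_identityRows {Γ : Type*} [Group Γ] (rint : Γ →* GL (Fin 4) O)
    (N : Matrix (Fin 4) (Fin 2) O) (i j : Fin 4)
    (hNi0 : N i 0 = 1) (hNi1 : N i 1 = 0) (hNj0 : N j 0 = 0) (hNj1 : N j 1 = 1)
    (T : Γ → Matrix (Fin 2) (Fin 2) O) (hT : ∀ g, (rint g).val * N = N * T g) :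
    ∃ Tu : Γ →* GL (Fin 2) O, ∀ g, (Tu g).val = T g := by
  have hcancel : ∀ S S' : Matrix (Fin 2) (Fin 2) O, N * S = N * S' → S = S' := fun S S' h => by
    ext c c'
    have hi := congrFun (congrFun h i) c'
    have hj := congrFun (congrFun h j) c'
    simp only [Matrix.mul_apply, Fin.sum_univ_two, hNi0, hNi1, hNj0, hNj1, one_mul, zero_mul, add_zero,
      zero_add] at hi hj
    fin_cases c <;> assumption
  have hmul : ∀ g g', T (g * g') = T g * T g' := fun g g' => hcancel _ _ (by
    rw [← hT, map_mul, Units.val_mul, Matrix.mul_assoc, hT g', ← Matrix.mul_assoc, hT g, Matrix.mul_assoc])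
  have hone : T 1 = 1 := hcancel _ _ (by rw [← hT, map_one, Units.val_one, Matrix.one_mul, Matrix.mul_one])
  exact ⟨{ toFun := fun g => ⟨T g, T g⁻¹, by rw [← hmul, mul_inv_cancel, hone],
             by rw [← hmul, inv_mul_cancel, hone]⟩,
           map_one' := Units.ext hone,
           map_mul' := fun g g' => Units.ext (hmul g g') }, fun g => rfl⟩

/-- If `C = Z τ' - T Z` then the unipotent `(1, Z; 0, 1)` block-diagonalises `(T, C; 0, τ')`. [folklore] -/
theorem unipotent_conj_fromBlocks (T C τ' Z : Matrix (Fin 2) (Fin 2) O) (hC : C = Z * τ' - T * Z) :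
    Matrix.fromBlocks 1 (-Z) 0 1 * Matrix.fromBlocks T C 0 τ' * Matrix.fromBlocks 1 Z 0 1 =
      Matrix.fromBlocks T 0 0 τ' := by
  rw [hC, Matrix.fromBlocks_multiply, Matrix.fromBlocks_multiply, Matrix.fromBlocks_inj]
  refine ⟨?_, ?_, ?_, ?_⟩ <;> noncomm_ring

/-- A `(2 ⊕ 2)`-block matrix with `Jᵀ = -J` is `(J₁₁, X; -Xᵀ, Y)` with `J₁₁ᵀ = -J₁₁` and `Yᵀ = -Y`. [folklore] -/
theorem fromBlocks_of_transpose_eq_neg (J : Matrix (Fin 2 ⊕ Fin 2) (Fin 2 ⊕ Fin 2) O) (hJ : Jᵀ = -J) :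
    J = Matrix.fromBlocks J.toBlocks₁₁ J.toBlocks₁₂ (-(J.toBlocks₁₂)ᵀ) J.toBlocks₂₂ ∧
      (J.toBlocks₁₁)ᵀ = -J.toBlocks₁₁ ∧ (J.toBlocks₂₂)ᵀ = -J.toBlocks₂₂ := by
  rw [← Matrix.fromBlocks_toBlocks J, Matrix.fromBlocks_transpose, Matrix.fromBlocks_neg,
    Matrix.fromBlocks_inj] at hJ
  obtain ⟨h11, -, h12, h22⟩ := hJ
  refine ⟨?_, h11, h22⟩
  conv_lhs => rw [← Matrix.fromBlocks_toBlocks J]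
  rw [Matrix.fromBlocks_inj]
  exact ⟨rfl, rfl, by rw [h12, neg_neg], rfl⟩

/-- The similitude identity `rᵀ J r = ν J` conjugated by a frame `P`: `P⁻¹ r P` is a similitude of `Pᵀ J P`. [folklore] -/
theorem similitude_conj {n : Type*} [Fintype n] [DecidableEq n] (P : GL n O) (r J : Matrix n n O) (ν : O)
    (h : rᵀ * J * r = ν • J) :
    ((P⁻¹).val * r * P.val)ᵀ * (P.valᵀ * J * P.val) * ((P⁻¹).val * r * P.val) = ν • (P.valᵀ * J * P.val) := by
  calc ((P⁻¹).val * r * P.val)ᵀ * (P.valᵀ * J * P.val) * ((P⁻¹).val * r * P.val)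
      = P.valᵀ * (rᵀ * ((P.val * (P⁻¹).val)ᵀ * J * (P.val * (P⁻¹).val)) * r) * P.val := by
        simp only [Matrix.transpose_mul, Matrix.mul_assoc]
    _ = ν • (P.valᵀ * J * P.val) := by
        rw [Units.mul_inv, Matrix.transpose_one, Matrix.one_mul, Matrix.mul_one, h, Matrix.mul_smul,
          Matrix.smul_mul]

end Frame

/-- If `S A = A Tr` with `A` invertible, then `c • Trᵀ⁻¹` and `c • Sᵀ⁻¹` are conjugate (by `Aᵀ`), hence have the same
characteristic polynomial. [folklore] -/
theorem charpoly_smul_transpose_inv_of_conj {k : Type*} [Field k] (A : GL (Fin 2) k)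
    (S Tr : Matrix (Fin 2) (Fin 2) k) (h : S * A.val = A.val * Tr) (c : k) :
    (c • Trᵀ⁻¹).charpoly = (c • Sᵀ⁻¹).charpoly := by
  have hTr : Tr = (A⁻¹).val * (S * A.val) := by rw [h, ← Matrix.mul_assoc, Units.inv_mul, Matrix.one_mul]
  have hAt : IsUnit A.valᵀ.det := by
    rw [Matrix.det_transpose]
    exact Matrix.isUnits_det_units A
  have hinv : ((A⁻¹).valᵀ)⁻¹ = A.valᵀ :=
    Matrix.inv_eq_right_inv (by rw [← Matrix.transpose_mul, Units.mul_inv, Matrix.transpose_one])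
  rw [hTr, Matrix.transpose_mul, Matrix.transpose_mul, Matrix.mul_inv_rev, Matrix.mul_inv_rev, hinv,
    ← Matrix.mul_smul, Matrix.charpoly_mul_comm, Matrix.smul_mul, Matrix.nonsing_inv_mul_cancel_right _ _ hAt]

/-! ### The multiplier of a symplectic integral frame is a unit character -/

section Multiplier

variable {p : ℕ} [Fact p.Prime]

/-- A unit of `ℤ̄_p = 𝒪[ℚ̄_p]` has norm `1`. [folklore] -/
theorem norm_eq_one_of_isUnit_integer {x : 𝒪[PadicAlgCl p]} (hx : IsUnit x) : ‖(x : PadicAlgCl p)‖ = 1 := by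
  have h := (Valuation.Integers.isUnit_iff_valuation_eq_one
    (Valuation.integer.integers (Valued.v (R := PadicAlgCl p)))).mp hx
  change Valued.v (x : PadicAlgCl p) = 1 at h
  rwa [PadicAlgCl.valuation_def, ← NNReal.coe_inj, coe_nnnorm, NNReal.coe_one] at h

/-- **The multiplier is a unit character.**  If the homomorphism `rint : Γ → GL₄(ℤ̄_p)` is symplectic over `ℚ̄_p` for a
non-degenerate `J` with multiplier `ν` (`rᵀ J r = ν J`), then `ν` is multiplicative (compare `ν(gh) J = ν(g)ν(h) J` at a
non-zero entry of `J`) with `‖ν g‖ = 1` (`ν⁴ = det(r)²`, `det r ∈ ℤ̄_pˣ`): a homomorphism `Γ → ℤ̄_pˣ`. [folklore] -/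
theorem exists_multiplierHom {Γ : Type*} [Group Γ] (rint : Γ →* GL (Fin 4) 𝒪[PadicAlgCl p])
    (J : Matrix (Fin 4) (Fin 4) (PadicAlgCl p)) (ν : Γ → PadicAlgCl p) (hJu : J.det ≠ 0)
    (hJ : ∀ g, (Matrix.GeneralLinearGroup.map (𝒪[PadicAlgCl p]).subtype (rint g)).valᵀ * J *
      (Matrix.GeneralLinearGroup.map (𝒪[PadicAlgCl p]).subtype (rint g)).val = ν g • J) :
    ∃ χ : Γ →* (𝒪[PadicAlgCl p])ˣ, ∀ g, (((χ g : (𝒪[PadicAlgCl p])ˣ) : 𝒪[PadicAlgCl p]) : PadicAlgCl p) = ν g := by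
  -- the frame over `ℚ̄_p` as a homomorphism
  set rK : Γ →* GL (Fin 4) (PadicAlgCl p) := (Matrix.GeneralLinearGroup.map (𝒪[PadicAlgCl p]).subtype).comp rint
    with hrK
  have hJ' : ∀ g, (rK g).valᵀ * J * (rK g).val = ν g • J := hJ
  have hJ0 : J ≠ 0 := fun h0 => hJu (by rw [h0, Matrix.det_zero])
  obtain ⟨r, hr⟩ := Function.ne_iff.mp hJ0
  obtain ⟨c, hrc⟩ := Function.ne_iff.mp hr
  have hcancel : ∀ a b : PadicAlgCl p, a • J = b • J → a = b := fun a b hab => by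
    have h1 := congrFun (congrFun hab r) c
    simp only [Matrix.smul_apply, smul_eq_mul] at h1
    exact mul_right_cancel₀ hrc h1
  have hmul : ∀ g g', ν (g * g') = ν g * ν g' := fun g g' => hcancel _ _ (by
    rw [← hJ' (g * g'), map_mul, Units.val_mul, Matrix.transpose_mul]
    calc (rK g').valᵀ * (rK g).valᵀ * J * ((rK g).val * (rK g').val)
        = (rK g').valᵀ * ((rK g).valᵀ * J * (rK g).val) * (rK g').val := by simp only [Matrix.mul_assoc]
      _ = (ν g * ν g') • J := by rw [hJ' g, Matrix.mul_smul, Matrix.smul_mul, hJ' g', smul_smul])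
  have hone : ν 1 = 1 := hcancel _ _ (by
    rw [← hJ' 1, map_one, Units.val_one, Matrix.transpose_one, Matrix.one_mul, Matrix.mul_one, one_smul])
  have hν0 : ∀ g, ν g ≠ 0 := fun g h0 => by
    have h1 := hmul g g⁻¹
    rw [mul_inv_cancel, hone, h0, zero_mul] at h1
    exact one_ne_zero h1
  have hnorm : ∀ g, ‖ν g‖ = 1 := fun g => by
    have h1 : ‖(rK g).val.det‖ = 1 := by
      have h2 : (rK g).val.det = (𝒪[PadicAlgCl p]).subtype (rint g).val.det := by
        rw [RingHom.map_det]
        rfl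
      rw [h2]
      exact norm_eq_one_of_isUnit_integer (Matrix.isUnits_det_units (rint g))
    have h3 : ‖ν g‖ ^ 4 = 1 := by rw [← norm_pow, ← det_sq_eq_of_symplectic hJu (hJ' g), norm_pow, h1, one_pow]
    exact (pow_eq_one_iff_of_nonneg (norm_nonneg _) (by norm_num)).mp h3
  have hmem : ∀ g, ν g ∈ 𝒪[PadicAlgCl p] := fun g => (mem_integer_iff_norm_le_one _).mpr (hnorm g).le
  have hmem' : ∀ g, (ν g)⁻¹ ∈ 𝒪[PadicAlgCl p] := fun g =>
    (mem_integer_iff_norm_le_one _).mpr (by rw [norm_inv, hnorm, inv_one])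
  exact ⟨{ toFun := fun g => ⟨⟨ν g, hmem g⟩, ⟨(ν g)⁻¹, hmem' g⟩, Subtype.ext (mul_inv_cancel₀ (hν0 g)),
             Subtype.ext (inv_mul_cancel₀ (hν0 g))⟩,
           map_one' := Units.ext (Subtype.ext hone),
           map_mul' := fun g g' => Units.ext (Subtype.ext (hmul g g')) }, fun g => rfl⟩

end Multiplier

/-! ### The registered stub -/

/-- **Registered sub-goal T8-plane `stub_noStablePlaneSymplectic`** (crux stmt-Langlands-13639, line
`sector-klingen-split`, skeleton rev 8): an integral frame `rint : Γ →* GL₄(ℤ̄_p)` realising a NON-trivial class `B` of a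
NON-TWIST pair `(σ, σ')`, SYMPLECTIC over `ℚ̄_p` for a non-degenerate alternating `J` with multiplier `ν` (`p ≠ 2`), has NO
stable plane: saturate (T4), orient (T5), complete to a block-triangularising frame, and apply the symplectic block
dichotomy (T6) — the block-diagonalisable case contradicts "no decomposable realiser" (p146441), the Lagrangian case makes
`(σ, σ')` a twist pair by T8c + T8b + T7. [folklore] -/
theorem stub_noStablePlaneSymplectic :
    ∀ (p : ℕ) [Fact p.Prime], p ≠ 2 → ∀ (k : Type) [Field k] [CharP k p] [IsAlgClosed k] (Γ : Type) [Group Γ]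
      (red : Valued.integer (PadicAlgCl p) →+* k) (σ σ' : Γ →* GL (Fin 2) k),
      Representation.IsIrreducible ((glStdRepresentation (Fin 2) k).comp σ) →
      Representation.IsIrreducible ((glStdRepresentation (Fin 2) k).comp σ') →
      (¬ ∃ g : GL (Fin 2) k, ∀ x, ∃ c : k, (g * σ x * g⁻¹).val = c • (σ' x).val) →
      ∀ (B : Γ → Matrix (Fin 2) (Fin 2) k),
      (¬ ∃ X : Matrix (Fin 2) (Fin 2) k, ∀ g, B g = (σ g).val * X - X * (σ' g).val) →
      ∀ (rint : Γ →* GL (Fin 4) (Valued.integer (PadicAlgCl p))) (h : GL (Fin 4) k),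
      (∀ g, (Matrix.GeneralLinearGroup.map red (rint g)).val =
          h.val * Matrix.reindex finSumFinEquiv finSumFinEquiv
            (Matrix.fromBlocks (σ g).val (B g) 0 (σ' g).val) * (h⁻¹).val) →
      ∀ (J : Matrix (Fin 4) (Fin 4) (PadicAlgCl p)) (ν : Γ → PadicAlgCl p), Jᵀ = -J → J.det ≠ 0 →
      (∀ g, (Matrix.GeneralLinearGroup.map (Valued.integer (PadicAlgCl p)).subtype (rint g)).valᵀ * J *
          (Matrix.GeneralLinearGroup.map (Valued.integer (PadicAlgCl p)).subtype (rint g)).val = ν g • J) →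
      ¬ ∃ M : Matrix (Fin 4) (Fin 2) (PadicAlgCl p), (∀ a : Fin 2 → PadicAlgCl p, M *ᵥ a = 0 → a = 0) ∧
          ∀ g, ∃ T : Matrix (Fin 2) (Fin 2) (PadicAlgCl p),
            (Matrix.GeneralLinearGroup.map (Valued.integer (PadicAlgCl p)).subtype (rint g)).val * M = M * T := by
  intro p _ hp k _ _ _ Γ _ red σ σ' hσ hσ' hnt B hB rint h hred J ν hJt hJu hJ
  rintro ⟨M, hMinj, hM⟩
  set sub := (Valued.integer (PadicAlgCl p)).subtype with hsub
  have hred' : ∀ g, (rint g).val.map red = h.val * Matrix.reindex finSumFinEquiv finSumFinEquiv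
      (Matrix.fromBlocks (σ g).val (B g) 0 (σ' g).val) * (h⁻¹).val := fun g => hred g
  -- (1) saturation of the stable plane over `ℤ̄_p` (T4); the action `T` is a homomorphism `Γ → GL₂(ℤ̄_p)`
  obtain ⟨N, -, i, j, T, hij, hNi0, hNi1, hNj0, hNj1, -, -, hT⟩ :=
    stub_stablePlaneSaturation p Γ (fun g => (rint g).val) M hMinj hM
  obtain ⟨Tu, hTu⟩ := exists_unitsHom_of_identityRows rint N i j hNi0 hNi1 hNj0 hNj1 T hT
  have hTuK : ∀ g, (Matrix.GeneralLinearGroup.map sub (Tu g)).val = (T g).map sub := fun g => by rw [← hTu g]; rfl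
  have hTuk : ∀ g, (Matrix.GeneralLinearGroup.map red (Tu g)).val = (T g).map red := fun g => by rw [← hTu g]; rfl
  -- (2) completion of `N` to a frame `Q ∈ GL₄(ℤ̄_p)` in which `rint` is block upper triangular
  obtain ⟨Q, C, τ', hfr⟩ := exists_blockTriangularFrame (fun g => (rint g).val) N i j hij hNi0 hNi1 hNj0 hNj1 T hT
  -- (3) residual orientation (T5): `red T ∼ σ`; then `charpoly (red τ') = charpoly σ'` (T8b)
  have hNinj : ∀ a : Fin 2 → k, N.map red *ᵥ a = 0 → a = 0 := fun a ha => by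
    have hi := congrFun ha i
    have hj := congrFun ha j
    simp only [Matrix.mulVec, dotProduct, Fin.sum_univ_two, Matrix.map_apply, hNi0, hNi1, hNj0, hNj1, map_one,
      map_zero, one_mul, zero_mul, add_zero, zero_add, Pi.zero_apply] at hi hj
    exact funext fun c => by fin_cases c <;> assumption
  have hstab : ∀ g, h.val * Matrix.reindex finSumFinEquiv finSumFinEquiv
      (Matrix.fromBlocks (σ g).val (B g) 0 (σ' g).val) * (h⁻¹).val * N.map red = N.map red * (T g).map red :=
    fun g => by rw [← hred' g, ← Matrix.map_mul, hT g, Matrix.map_mul]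
  obtain ⟨Ab, hAb⟩ :=
    stub_residualPlaneOrientation k Γ σ σ' hσ hσ' B hB h (N.map red) (fun g => (T g).map red) hNinj hstab
  obtain ⟨W, hW⟩ : ∃ W : GL (Fin 4) k, W = Matrix.GeneralLinearGroup.map red Q⁻¹ := ⟨_, rfl⟩
  have hτ'red : ∀ g, ((τ' g).map red).charpoly = (σ' g).val.charpoly :=
    stub_blockTriangularCharpolyReduction p k Γ red σ σ' B h W Ab T C τ' (fun g => (Q⁻¹).val * (rint g).val * Q.val)
      hfr (fun g => by rw [hW, map_inv, inv_inv, Matrix.map_mul, Matrix.map_mul, hred' g]; rfl) hAb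
  -- (4) the multiplier is a unit character `χ : Γ → ℤ̄_pˣ`
  obtain ⟨χ, hχ⟩ := exists_multiplierHom rint J ν hJu hJ
  have hν0 : ∀ g, ν g ≠ 0 := fun g h0 => (χ g).ne_zero (Subtype.ext ((hχ g).trans h0))
  -- (5) the conjugated frame over `ℚ̄_p` is block upper triangular; its Gram matrix `J'` in `2 × 2` blocks
  obtain ⟨QK, hQK⟩ : ∃ QK : GL (Fin 4) (PadicAlgCl p), QK = Matrix.GeneralLinearGroup.map sub Q := ⟨_, rfl⟩
  have hS : ∀ g, ((QK⁻¹ * Matrix.GeneralLinearGroup.map sub (rint g) * QK : GL (Fin 4) (PadicAlgCl p)) :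
      Matrix (Fin 4) (Fin 4) (PadicAlgCl p)) = Matrix.reindex finSumFinEquiv finSumFinEquiv
        (Matrix.fromBlocks ((T g).map sub) ((C g).map sub) 0 ((τ' g).map sub)) := fun g => by
    rw [hQK, ← map_inv, ← map_mul, ← map_mul]
    change ((Q⁻¹ * rint g * Q).val).map sub = _
    rw [Units.val_mul, Units.val_mul, hfr g, Matrix.reindex_apply, Matrix.reindex_apply, ← Matrix.submatrix_map,
      Matrix.fromBlocks_map, Matrix.map_zero _ (map_zero _)]
  obtain ⟨J', hJ'⟩ : ∃ J' : Matrix (Fin 2 ⊕ Fin 2) (Fin 2 ⊕ Fin 2) (PadicAlgCl p),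
      J' = (QK.valᵀ * J * QK.val).submatrix finSumFinEquiv finSumFinEquiv := ⟨_, rfl⟩
  have hJ't : J'ᵀ = -J' := by
    rw [hJ', Matrix.transpose_submatrix, Matrix.transpose_mul, Matrix.transpose_mul, Matrix.transpose_transpose, hJt]
    simp only [Matrix.mul_neg, Matrix.neg_mul, Matrix.mul_assoc]
    rfl
  have hJ'det : J'.det ≠ 0 := by
    rw [hJ', Matrix.det_submatrix_equiv_self, Matrix.det_mul, Matrix.det_mul, Matrix.det_transpose]
    have hQdet : QK.val.det ≠ 0 := (Matrix.isUnits_det_units QK).ne_zero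
    exact mul_ne_zero (mul_ne_zero hQdet hJu) hQdet
  obtain ⟨hJ'blk, hJ11t, hYt⟩ := fromBlocks_of_transpose_eq_neg J' hJ't
  -- the block similitude identity, read from `rᵀ J r = ν J` conjugated by `Q_K`
  have hsim : ∀ g, (Matrix.fromBlocks ((T g).map sub) ((C g).map sub) 0 ((τ' g).map sub))ᵀ * J' *
      Matrix.fromBlocks ((T g).map sub) ((C g).map sub) 0 ((τ' g).map sub) = ν g • J' := fun g => by
    have h1 := similitude_conj QK _ J (ν g) (hJ g)
    rw [← Units.val_mul, ← Units.val_mul] at h1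
    have h2 : ((QK⁻¹ * Matrix.GeneralLinearGroup.map sub (rint g) * QK : GL (Fin 4) (PadicAlgCl p)) :
        Matrix (Fin 4) (Fin 4) (PadicAlgCl p)).submatrix finSumFinEquiv finSumFinEquiv =
        Matrix.fromBlocks ((T g).map sub) ((C g).map sub) 0 ((τ' g).map sub) := by
      rw [hS g, Matrix.reindex_apply, Matrix.submatrix_submatrix, Equiv.symm_comp_self, Matrix.submatrix_id_id]
    rw [← h2, hJ', Matrix.transpose_submatrix, Matrix.submatrix_mul_equiv, Matrix.submatrix_mul_equiv, h1]
    rfl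
  have hTunit : ∀ g, IsUnit ((T g).map sub).det := fun g => by
    simpa only [hTuK] using Matrix.isUnits_det_units (Matrix.GeneralLinearGroup.map sub (Tu g))
  -- (6) the symplectic block dichotomy (T6)
  rcases stub_symplecticBlockDichotomy (PadicAlgCl p) two_ne_zero Γ (fun g => (T g).map sub) (fun g => (τ' g).map sub)
      (fun g => (C g).map sub) ν J'.toBlocks₁₁ J'.toBlocks₁₂ J'.toBlocks₂₂ hJ11t hYt (by rw [← hJ'blk]; exact hJ'det)
      hTunit hν0 (fun g => by rw [← hJ'blk]; exact hsim g) with ⟨-, hX, hLag⟩ | ⟨Z, hZ⟩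
  · -- Lagrangian plane: `σ'` has the characteristic polynomials of `χ̄ ⊗ σ⁻ᵀ` (T8c, T8b): a twist pair (T7)
    have hcp : ∀ g, (σ' g).val.charpoly =
        (((((Units.map (red : 𝒪[PadicAlgCl p] →* k)).comp χ) g : kˣ) : k) • ((σ g).val)ᵀ⁻¹).charpoly := fun g => by
      have h8c := stub_lagrangianQuotientCharpoly p k red (Tu g) (τ' g) J'.toBlocks₁₂
        ((χ g : (𝒪[PadicAlgCl p])ˣ) : 𝒪[PadicAlgCl p]) hX (by rw [hTuK, hχ g]; exact hLag g)
      rw [← hτ'red g, h8c, hTuk, charpoly_smul_transpose_inv_of_conj Ab (σ g).val ((T g).map red) (hAb g)]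
      simp only [MonoidHom.comp_apply, Units.coe_map, MonoidHom.coe_coe]
    obtain ⟨A', hA'⟩ := stub_twistOfDualCharpoly k Γ σ σ' _ hσ hσ' hcp
    exact hnt ⟨A', hA'⟩
  · -- block-diagonalisable plane: contradiction with "no decomposable realiser" (p146441)
    have hnc : ¬ ∃ u : GL (Fin 2) k, ∀ x, u * σ x * u⁻¹ = σ' x :=
      fun ⟨u, hu⟩ => hnt ⟨u, fun x => ⟨1, by rw [hu x, one_smul]⟩⟩
    have hU1 := Ribet.fromBlocks_unipotent_mul_neg Z
    have hU2 := Ribet.fromBlocks_unipotent_mul_neg (-Z)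
    rw [neg_neg] at hU2
    obtain ⟨U₀, hU₀⟩ : ∃ U₀ : Matrix (Fin 4) (Fin 4) (PadicAlgCl p), U₀ = (Matrix.fromBlocks 1 Z 0 1).submatrix
        (finSumFinEquiv (m := 2) (n := 2)).symm (finSumFinEquiv (m := 2) (n := 2)).symm := ⟨_, rfl⟩
    obtain ⟨U₁, hU₁⟩ : ∃ U₁ : Matrix (Fin 4) (Fin 4) (PadicAlgCl p), U₁ = (Matrix.fromBlocks 1 (-Z) 0 1).submatrix
        (finSumFinEquiv (m := 2) (n := 2)).symm (finSumFinEquiv (m := 2) (n := 2)).symm := ⟨_, rfl⟩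
    have hUU : U₀ * U₁ = 1 := by rw [hU₀, hU₁, Matrix.submatrix_mul_equiv, hU1, Matrix.submatrix_one_equiv]
    have hUU' : U₁ * U₀ = 1 := by rw [hU₀, hU₁, Matrix.submatrix_mul_equiv, hU2, Matrix.submatrix_one_equiv]
    obtain ⟨U, hUv, hUi⟩ : ∃ U : GL (Fin 4) (PadicAlgCl p), U.val = U₀ ∧ (U⁻¹).val = U₁ :=
      ⟨⟨U₀, U₁, hUU, hUU'⟩, rfl, rfl⟩
    refine Ribet.not_blockDiagonal_of_realises_nonsplit hp red σ σ' hσ hσ' hnc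
      (fun g => Matrix.GeneralLinearGroup.map sub (rint g)) 1 (fun g => rint g) h B
      (fun g => by rw [inv_one, one_mul, mul_one]) hred hB
      ⟨QK * U, fun g => (T g).map sub, fun g => (τ' g).map sub, fun g => ?_⟩
    have e5 : (QK * U)⁻¹ * Matrix.GeneralLinearGroup.map sub (rint g) * (QK * U) =
        U⁻¹ * (QK⁻¹ * Matrix.GeneralLinearGroup.map sub (rint g) * QK) * U := by
      rw [mul_inv_rev]
      simp only [mul_assoc]
    show ((((QK * U)⁻¹ * Matrix.GeneralLinearGroup.map sub (rint g) * (QK * U) : GL (Fin 4) (PadicAlgCl p)) :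
      Matrix (Fin 4) (Fin 4) (PadicAlgCl p))) = _
    rw [e5, Units.val_mul, Units.val_mul, hS g, hUv, hUi, hU₀, hU₁, Matrix.reindex_apply, Matrix.reindex_apply,
      Matrix.submatrix_mul_equiv, Matrix.submatrix_mul_equiv, unipotent_conj_fromBlocks _ _ _ Z (hZ g)]

end Summit.Langlands.Langlands.Cruxes.ResiduallyYoshidaLifting.SectorKlingenSplit.Fibre

end
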